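import Literature.MathematicalPhysics.QuantumFieldTheory.BalabanImbrieJaffe1984to88.BIJ88Eq596FibreIntegral

/-!
# `BalabanImbrieJaffe1984to88.BIJ88HoleProduct5154` — T. Bałaban, J. Imbrie, A. Jaffe, *Effective action and cluster properties of the abelian Higgs
model*, Commun. Math. Phys. **114** (1988) 257–315 [BalabanImbrieJaffe1988], the RESULT pp. 313–314 [PDF 57–58] and the hole functional (5.15.4) p. 314
[PDF 58]: **THE (4.1)-SHAPE AT LEVEL `k + 1` WITH THE PRODUCT OF HOLE FUNCTIONALS `Π_{ω′} g_{k+1}(X_{ω′})`, AS A FUNCTION OF `(v, ψ)`.**  The companion file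
`BIJ88Eq596FibreIntegral` (this seat, p318611) proves the RESULT as a function identity with the bracket of each hole family as the SUM over the compatible
expansion data (`result41_ae_eq`); the owner's remaining recorded gap for row C2.Claim@313 (r16 gen 11, 2026-08-22T03:22:11Z) is *"the per-hole
factorization of the fibre sum into Π_{ω′}g_{k+1}(X_{ω′}) × globals"*.  Here: GIVEN that factorization as the pointwise identity which (5.15.4) displays
(the hole functional = the sum over the data *"compatible with X_{ω′}"* of LOCAL factors, times the global factors `χ Π F Π[Z Z] exp[…]`), the measure-level
consequence is PROVED — the exterior `φ^{(k)}`-integral factorizes over the components (`dφ^{(k)}|_{ext} = Π_{ω′} dφ^{(k)}|_{ext ∩ X_{ω′}}`, Fubini), so that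
`ρ_{k+1}(v, ψ) = Σ_{{X_{ω′}}} ∫Π_{j≤k}du^{(j)} G · Π_{ω′} g_{k+1}(X_{ω′})` with every `g_{k+1}(X_{ω′})` a FUNCTION of the previous fields carrying its own
`∫dφ^{(k)}|_{Λ^{(k)c}_{10} ∩ X_{ω′}}` — the shape of r18's `BIJ88InductiveForm41.rhoPrime`/`rho` (`Π_ω g ω prev u φ` inside `∫ prev ∂prevMeasure`).

statement-level skeleton of published theorems with citation tags; proofs where landed; nothing here is a claim about the Yang–Mills mass gap

PDF held: `paper:balaban1988-cmp114-bij-abelian-higgs-effective-action` (journal page = PDF page + 256); pp. 273–274, 313–314 [PDF 17–18, 57–58] re-read this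
session (`HOME/lit-balaban-r16/renders/cmp114/original-p058-x2.png`, `HOME/lit-balaban-p34/c2-p057-x2.png` as images; text layer pp. 18, 57–58).
CITATION HEADER (lean-in-tree rule).  Part of the lit-balaban TYPED SKELETON (HOME `run/shared/lean/pub/lit-balaban/`), PHASE-2 proof seat p34 gen 11
(unit `lit-balaban-p34-g11`; own lineage, the C1/C2 renormalization-transformation line at measure level).  Rows served (owner r16, ROWS-C2-part2):
**C2.Claim@313** (the factorized (4.1)-form at `k + 1` as a function: `result41_hole_product`), **C2.Eq5.15.4** (the hole functional's OUTER shape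
`Σ_{compatible} ∫dφ^{(k)}|_{Λ^{(k)c}_{10}∩X_{ω′}} (…)` as a function of `{u^{(j)}}_{j≤k}`: `integral_hole_product`); r18's `C2.Eq4.1` (support).

THE PRINTED TEXT (verbatim, p. 313–314 [57–58]).  *"Let {X_{ω′}} be the components of Λ^{(k)c}_{13}, and let X_{ω′} also specify Λ^{(k)c}_α ∩ X_{ω′} and a
collection {X_ω} of sets from the previous step. We exhibit the factorization of most of the terms in ρ_{k+1}(v, ψ) by writing ρ_{k+1}(v, ψ) = Σ_{{X_{ω′}}}
∫Π_{j=0}^{k} du^{(j)}|_{Λ^{(j)c*}_{10}} ρ′_{k+1}(v, ψ, {X_{ω′}}, {u^{(j)}}), ρ′_{k+1}(…) = χ_{k+1,Λ^{(k)′}_0} Π_{ω′} g_{k+1}(X_{ω′}) Π_{σ′} F_{k+1,loc}(X_{σ′})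
Π_{j=0}^{k}[Z^{(j)}_{Λ^{(j)c*c}_{10}} Z^{(j)}_{Λ^{(j)}_{10}}(u_{k+1})] × exp[…], which is in the form of our original induction hypothesis, (4.1). The hole functional
has the expression g_{k+1}(X_{ω′}) = Σ_{S₄, σ̃₁, Λ̃^{(k)}_9∩X_{ω′}, {X_α}, {X_{r′}}, S₆ compatible with X_{ω′}} × ∫dφ^{(k)}|_{Λ^{(k)c}_{10}∩X_{ω′}} δ_{Ax,…}(u^{(k)})
δ_{…}(v/Qu^{(k)}) × … (5.15.4). Compatibility means that the summations run over sets associated only with X_{ω′}, and that the sets would have given us X_{ω′}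
in the course of our constructions."*

THE READING (carriers of record; nothing re-declared).  As in `BIJ88Eq596FibreIntegral`: `Π_{j≤k}𝒟u^{(j)}` = r18's `prevMeasure P (k+1)`; `dφ^{(k)}|_{ext}` =
Lebesgue measure on gen 10's `Interior.EX = ({x // x ∉ Λ^{(k)}_{10}} → ℂ)`; `cfg41` = the (4.1)-coordinates; the components `ω′ ∈ K_ω` of a hole family `ω`
with the assignment `comp_ω` of every exterior site to its component (`Λ^{(k)c}_{10} ⊂ Λ^{(k)c}_{13} = ∪_{ω′} X_{ω′}`); the δ-functions of (5.15.4) are realized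
by the fibre variable of the companion file inside the local factors `y`.  HYPOTHESES DISPLAYED, NOT PROVED: the pointwise product identity `hprod` (=
the combinatorial content of (5.15.4): the compatible data of a hole family are chosen independently per component and every factor is local) and the
coincidence `hD` of the interior sets `Λ_{10}` of all data with the same hole family (p. 313: *"X_{ω′} also specify Λ^{(k)c}_α ∩ X_{ω′}"*).

WHAT IS PROVED (kernel-checked; theorems only — no `def`, no `Prop`-valued fact; standard axioms; imports the companion file only).
* §1 (private plumbing: currying a finite product of sigma-finite volumes along a `Σ`-type preserves volume — Mathlib has the `infinitePi` version only)
  **`integral_prod_blocks`**: `∫_{ℂ^S} Π_κ f_κ(e|_{block κ}) de = Π_κ ∫ f_κ` for any partition `comp : S → K` of a finite site set.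
* §2 **`integral_hole_product`** (one hole family: `∫_{Π𝒟u^{(j)} ⊗ dφ_ext} G·Π_{ω′}y_{ω′} = ∫_{Π𝒟u^{(j)}} G·Π_{ω′}(∫dφ|_{ext∩X_{ω′}} y_{ω′})`), **`ae_eq_hole_product`**
  (from a function-level RESULT of the shape of `result41_ae_eq`, `hD`, `hprod`, integrable terms: `ρ̃(v, ψ) =ᵐ Σ_ω ∫_{prevMeasure P (k+1)} G_ω · Π_{ω′}
  g_{k+1}(X_{ω′})`).
* §3 **`result41_hole_product`**: the whole passage from line 1 of (5.9.6) (`IsDT (𝒟u δ_{Ax})`) to the factorized (4.1)-form at `k + 1`, as one theorem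
  (`result41_ae_eq` + §2).
NOT DONE HERE (honest scope).  The combinatorics of *"compatible with X_{ω′}"* (that the expansion data of Sects. 5.11–5.14 restricted to a hole family are a
product over its components) and the locality of each factor — displayed as `hprod`; the packaging into r18's `Term41` record ((4.2)–(4.9) at `k + 1`);
bounds on `g_{k+1}`.
-/

namespace Literature.MathematicalPhysics.QuantumFieldTheory.BalabanImbrieJaffe1984to88.BIJ88HoleProduct5154

open Literature.MathematicalPhysics.QuantumFieldTheory.Balaban1983to89
open BIJ88Sect3Statements (U1)
open BIJ85Sect1Model (HiggsField)
open BIJ88RenormTransf311 (axialMeasure axialBonds)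
open BIJ88InductiveForm41 (Prev prevMeasure)
open BIJ85BlockAveragesTorus (qU surfMul uPrime)
open BIJ88Eq536Linearization (cutoff)
open BIJ88RT52Restrictions (Fields fieldsMeasure)
open BIJ88Eq596Display (uCut IsDT)
open BIJ88Eq5128Split (Cfg Interior)
open BIJ88Eq5128Display (axialLaw)
open BIJ88Eq5128Display.Weight (normW condW)
open BIJ88FinalForm313 (cfg41)
open BIJ88Eq596FibreIntegral (result41_ae_eq)
open scoped BigOperators ENNReal
open _root_.MeasureTheory _root_.MeasureTheory.Measure Function Set

noncomputable section

variable {P : Params} {k : ℕ}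

/-! ## §1 Lebesgue measure on `ℂ^{sites}` is the product over a partition of the sites -/

section Blocks

variable {S K : Type*} (comp : S → K)

/-- kernel: **currying a finite product of sigma-finite volumes along a `Σ`-type preserves volume** (`(p : Σ i, κ i) → X` versus `Π i, (κ i → X)`;
Mathlib has the probability/`infinitePi` version only). [folklore] -/
private theorem volume_preserving_piCurry_symm {ι : Type*} [Fintype ι] {κ : ι → Type*} [∀ i, Fintype (κ i)] (X : Type*) [MeasureSpace X]
    [SigmaFinite (volume : Measure X)] :
    MeasurePreserving (MeasurableEquiv.piCurry fun (i : ι) (_ : κ i) => X).symm volume volume := by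
  refine ⟨(MeasurableEquiv.piCurry fun (i : ι) (_ : κ i) => X).symm.measurable, ?_⟩
  rw [volume_pi]
  refine (Measure.pi_eq fun s hs => ?_).symm
  rw [MeasurableEquiv.map_apply]
  have hpre : (MeasurableEquiv.piCurry fun (i : ι) (_ : κ i) => X).symm ⁻¹' Set.univ.pi s =
      Set.univ.pi fun i => Set.univ.pi fun j => s ⟨i, j⟩ := by
    ext w
    simp only [Set.mem_preimage, Set.mem_univ_pi, MeasurableEquiv.coe_piCurry_symm, Sigma.uncurry, Sigma.forall]
  rw [hpre, Measure.pi_pi]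
  simp_rw [volume_pi, Measure.pi_pi]
  rw [← Finset.univ_sigma_univ, Finset.prod_sigma]

/-- kernel: the same for the forward currying map. [folklore] -/
private theorem volume_preserving_piCurry {ι : Type*} [Fintype ι] {κ : ι → Type*} [∀ i, Fintype (κ i)] (X : Type*) [MeasureSpace X]
    [SigmaFinite (volume : Measure X)] :
    MeasurePreserving (MeasurableEquiv.piCurry fun (i : ι) (_ : κ i) => X) volume volume := by
  simpa only [MeasurableEquiv.symm_symm] using (volume_preserving_piCurry_symm (κ := κ) X).symm _

variable [Fintype S] [Fintype K] [DecidableEq K]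

/-- **The integral of a product of block functions is the product of the block integrals**: for a partition `comp : S → K` of a finite site set,
`∫_{ℂ^S} Π_κ f_κ(e|_{block κ}) de = Π_κ ∫_{ℂ^{block κ}} f_κ` — Lebesgue measure on `ℂ^S` regrouped by blocks (`e ↦ (κ ↦ e|_{block κ})` =
`piCongrLeft` along `Equiv.sigmaFiberEquiv comp`, then `piCurry`; both preserve volume) and Mathlib's `integral_fintype_prod_eq_prod` (no integrability
hypothesis) — the kernel fact behind `∫dφ^{(k)}|_{Λ^{(k)c}_{10}} = Π_{ω′} ∫dφ^{(k)}|_{Λ^{(k)c}_{10} ∩ X_{ω′}}` in (5.15.4). [cite: BalabanImbrieJaffe1988, (5.15.4) p.314] -/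
theorem integral_prod_blocks (f : (κ : K) → ({x : S // comp x = κ} → ℂ) → ℂ) :
    ∫ e : S → ℂ, ∏ κ, f κ (fun j => e j.1) = ∏ κ, ∫ w : {x : S // comp x = κ} → ℂ, f κ w := by
  -- the regrouping as a volume-preserving measurable equivalence
  have hE : MeasurePreserving
      (((MeasurableEquiv.piCongrLeft (fun _ : S => ℂ) (Equiv.sigmaFiberEquiv comp)).symm).trans
        (MeasurableEquiv.piCurry fun (κ : K) (_ : {x : S // comp x = κ}) => ℂ))
      (volume : Measure (S → ℂ)) (volume : Measure ((κ : K) → ({x : S // comp x = κ} → ℂ))) :=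
    ((volume_measurePreserving_piCongrLeft (fun _ : S => ℂ) (Equiv.sigmaFiberEquiv comp)).symm _).trans
      (volume_preserving_piCurry (κ := fun κ => {x : S // comp x = κ}) ℂ)
  have h1 : ∫ e : S → ℂ, ∏ κ, f κ (fun j => e j.1) = ∫ w : (κ : K) → ({x : S // comp x = κ} → ℂ), ∏ κ, f κ (w κ) := by
    rw [← hE.integral_comp' (g := fun w : (κ : K) → ({x : S // comp x = κ} → ℂ) => ∏ κ, f κ (w κ))]
    rfl
  rw [h1, volume_pi, integral_fintype_prod_eq_prod]

end Blocks

/-! ## §2 One hole family: the exterior `φ^{(k)}`-integral of (globals) × Π_{ω′} (block functions) -/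

section Hole

variable {K : Type*} [Fintype K] [DecidableEq K]

/-- **One hole family `{X_{ω′}}`: the (4.1)-integrand at level `k + 1` from a product over the components.**  If the integrand on r18's carriers
`({u^{(j)}}_{j≤k}, φ^{(k)}|_{ext})` factorizes POINTWISE as a function `G({u^{(j)}})` (the global factors: `χ`, `ΠF`, `ΠZ`, the exponential) times a
product over the components `ω′` of functions `y_{ω′}({u^{(j)}}, φ^{(k)}|_{ext ∩ X_{ω′}})` of the exterior scalar variables IN `X_{ω′}` only (`comp` assigns
every exterior site to its component), then its `Π𝒟u^{(j)} ⊗ dφ^{(k)}|_{ext}`-integral is `∫_{Π𝒟u^{(j)}} G · Π_{ω′} g_{ω′}` with the HOLE FUNCTIONALS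
`g_{ω′}({u^{(j)}}) := ∫dφ^{(k)}|_{ext ∩ X_{ω′}} y_{ω′}` — the `∫dφ^{(k)}|_{Λ^{(k)c}_{10} ∩ X_{ω′}}` of (5.15.4) (Fubini; `dφ_ext = Π_{ω′} dφ|_{ext ∩ X_{ω′}}`, §1).
[cite: BalabanImbrieJaffe1988, (5.15.4) p.314] -/
theorem integral_hole_product (D : Interior P k) (comp : {x : Balaban1983to89.Site P k // x ∉ D.Ix} → K)
    {F : Prev P (k+1) × D.EX → ℂ} {G : Prev P (k+1) → ℂ} {y : (κ : K) → Prev P (k+1) → ({x // comp x = κ} → ℂ) → ℂ}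
    (hF : ∀ pp e, F (pp, e) = G pp * ∏ κ, y κ pp (fun j => e j.1))
    (hFi : Integrable F ((prevMeasure P (k+1)).prod (volume : Measure D.EX))) :
    ∫ r, F r ∂(prevMeasure P (k+1)).prod (volume : Measure D.EX) =
      ∫ pp, (G pp * ∏ κ, ∫ w : {x // comp x = κ} → ℂ, y κ pp w) ∂prevMeasure P (k+1) := by
  rw [integral_prod _ hFi]
  refine integral_congr_ae (Filter.Eventually.of_forall fun pp => ?_)
  show ∫ e, F (pp, e) ∂(volume : Measure D.EX) = G pp * ∏ κ, ∫ w : {x // comp x = κ} → ℂ, y κ pp w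
  simp_rw [hF]
  rw [integral_const_mul, integral_prod_blocks]

variable {Ω ι' : Type*} {ρL : GaugeField P (k+1) U1 → HiggsField P (k+1) → ℂ}

/-- **THE RESULT pp. 313–314 WITH THE HOLE FUNCTIONALS AS A PRODUCT — r18's (4.1)-shape at level `k + 1`, as a FUNCTION of `(v, ψ)` (PROVED).**  INPUT:
a function-level RESULT of the shape of `BIJ88Eq596FibreIntegral.result41_ae_eq` — `ρ̃(v, ψ) = Σ_{ω ∈ holes} Σ_{c ∈ fam ω} ∫_{Π_{j≤k}𝒟u^{(j)} ⊗ dφ^{(k)}|_{ext_c}}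
Y_c(cfg41_c r; v, ψ) dr` a.e.; the interior sets of all data compatible with one hole family coincide (`hD`: p. 313 *"let X_{ω′} also specify Λ^{(k)c}_α ∩
X_{ω′}"*); integrable terms; and THE CONTENT OF (5.15.4) AS THE POINTWISE IDENTITY `hprod`: for each hole family `ω = {X_{ω′}}`, the sum over the compatible
data of the integrands is `G_ω({u^{(j)}}; v, ψ) · Π_{ω′} y_{ω,ω′}({u^{(j)}}, φ^{(k)}|_{ext ∩ X_{ω′}}; v, ψ)` (*"Compatibility means that the summations run over sets
associated only with X_{ω′} …"*).  CONCLUSION, `dv dψ`-a.e.: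
`ρ̃(v, ψ) = Σ_{ω ∈ holes} ∫_{Π_{j≤k}𝒟u^{(j)}} G_ω({u^{(j)}}; v, ψ) · Π_{ω′} g_{k+1}(X_{ω′})({u^{(j)}}; v, ψ)`, `g_{k+1}(X_{ω′}) := ∫dφ^{(k)}|_{ext ∩ X_{ω′}} y_{ω,ω′}` —
*"ρ_{k+1}(v, ψ) = Σ_{{X_{ω′}}} ∫Π_{j=0}^{k} du^{(j)} ρ′_{k+1}"* with *"ρ′_{k+1} = χ … Π_{ω′}g_{k+1}(X_{ω′}) Π_{σ′}F_{k+1,loc}(X_{σ′}) Π_j[Z Z] exp[…]"*: the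
hole functionals are FUNCTIONS of the previous fields inside the `Π𝒟u^{(j)}`-integral (r18's `Term41.g`), over r18's `prevMeasure P (k+1)`.
[cite: BalabanImbrieJaffe1988, (5.15.4) p.314] -/
theorem ae_eq_hole_product [DecidableEq Ω] {Y : ι' → Cfg P k → GaugeField P (k+1) U1 → HiggsField P (k+1) → ℂ} (D : ι' → Interior P k)
    (holes : Finset Ω) (fam : Ω → Finset ι')
    (hR : uncurry ρL =ᵐ[(fieldMeasure P (k+1) U1).prod volume]
      uncurry (fun v ψ => ∑ ω ∈ holes, ∑ c ∈ fam ω,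
        ∫ r, Y c (cfg41 (D c) r) v ψ ∂(prevMeasure P (k+1)).prod (volume : Measure (D c).EX)))
    (DΩ : Ω → Interior P k) (hD : ∀ ω ∈ holes, ∀ c ∈ fam ω, D c = DΩ ω)
    (KΩ : Ω → Type*) [∀ ω, Fintype (KΩ ω)] [∀ ω, DecidableEq (KΩ ω)]
    (comp : (ω : Ω) → {x : Balaban1983to89.Site P k // x ∉ (DΩ ω).Ix} → KΩ ω)
    (G : Ω → Prev P (k+1) → GaugeField P (k+1) U1 → HiggsField P (k+1) → ℂ)
    (y : (ω : Ω) → (κ : KΩ ω) → Prev P (k+1) → ({x // comp ω x = κ} → ℂ) → GaugeField P (k+1) U1 → HiggsField P (k+1) → ℂ)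
    (hprod : ∀ ω ∈ holes, ∀ (pp : Prev P (k+1)) (e : (DΩ ω).EX) (v : GaugeField P (k+1) U1) (ψ : HiggsField P (k+1)),
      ∑ c ∈ fam ω, Y c (cfg41 (DΩ ω) (pp, e)) v ψ = G ω pp v ψ * ∏ κ, y ω κ pp (fun j => e j.1) v ψ)
    (hYi : ∀ ω ∈ holes, ∀ c ∈ fam ω, ∀ (v : GaugeField P (k+1) U1) (ψ : HiggsField P (k+1)),
      Integrable (fun r => Y c (cfg41 (DΩ ω) r) v ψ) ((prevMeasure P (k+1)).prod (volume : Measure (DΩ ω).EX))) :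
    uncurry ρL =ᵐ[(fieldMeasure P (k+1) U1).prod volume]
      uncurry (fun v ψ => ∑ ω ∈ holes, ∫ pp, (G ω pp v ψ * ∏ κ, ∫ w : {x // comp ω x = κ} → ℂ, y ω κ pp w v ψ) ∂prevMeasure P (k+1)) := by
  filter_upwards [hR] with z hz
  rw [hz]
  simp only [uncurry]
  refine Finset.sum_congr rfl fun ω hω => ?_
  -- all compatible data share the interior sets of the hole family
  have e1 : ∀ c ∈ fam ω, (∫ r, Y c (cfg41 (D c) r) z.1 z.2 ∂(prevMeasure P (k+1)).prod (volume : Measure (D c).EX)) =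
      ∫ r, Y c (cfg41 (DΩ ω) r) z.1 z.2 ∂(prevMeasure P (k+1)).prod (volume : Measure (DΩ ω).EX) := by
    intro c hc
    rw [hD ω hω c hc]
  rw [Finset.sum_congr rfl e1, ← integral_finsetSum _ (fun c hc => hYi ω hω c hc z.1 z.2)]
  exact integral_hole_product (DΩ ω) (comp ω) (F := fun r => ∑ c ∈ fam ω, Y c (cfg41 (DΩ ω) r) z.1 z.2)
    (fun pp e => hprod ω hω pp e z.1 z.2) (integrable_finsetSum _ fun c hc => hYi ω hω c hc z.1 z.2)

end Hole

/-! ## §3 From line 1 of (5.9.6) to the factorized (4.1)-form at `k + 1` -/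

section Chain

variable {ι ι' Ω : Type*} {terms : Finset ι} {Λ : ι → Finset (PBond P (k+1))}
variable {J : ι → Prev P k → GaugeField P k U1 → GaugeField P (k+1) U1 → HiggsField P k → HiggsField P (k+1) → ℂ}
variable {ρL : GaugeField P (k+1) U1 → HiggsField P (k+1) → ℂ}

/-- **(5.9.6) ⇒ THE RESULT IN r18's (4.1)-SHAPE AT `k + 1` WITH `Π_{ω′} g_{k+1}(X_{ω′})`, AS A FUNCTION (PROVED modulo the displayed pointwise identities).**
The hypotheses of `BIJ88Eq596FibreIntegral.result41_ae_eq` (line 1 of (5.9.6) over `∫𝒟u δ_{Ax}`; the Sect. 5.12 factorization of the fibre bracket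
and weight data; the VALUE identity `hC` of Sects. 5.13–5.15 with integrable measurable products; the hole map), the coincidence `hD` of the interior
sets on each hole family, and (5.15.4) as the pointwise product identity `hprod` over the components; CONCLUSION: for `dv dψ`-a.e. `(v, ψ)`,
`ρ̃(v, ψ) = Σ_{ω ∈ holes} ∫_{Π_{j≤k}𝒟u^{(j)}} G_ω({u^{(j)}}; v, ψ) · Π_{ω′} (∫dφ^{(k)}|_{ext ∩ X_{ω′}} y_{ω,ω′})({u^{(j)}}; v, ψ)`. [cite: BalabanImbrieJaffe1988, (5.15.4) p.314] -/
theorem result41_hole_product [DecidableEq ι] [DecidableEq Ω] (hk : k + 1 ≤ P.m + P.K) (h : IsDT (axialMeasure P k U1) terms Λ qU J ρL)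
    (hJi : ∀ t ∈ terms, Integrable (fun q : Fields P k => J t q.2.1 (uCut qU (Λ t) q.1) (qU q.1) q.2.2.1 q.2.2.2) (fieldsMeasure (axialMeasure P k U1)))
    (hi : Integrable (uncurry ρL) ((fieldMeasure P (k+1) U1).prod volume)) (D : ι → Interior P k)
    (Xf B : ι → Cfg P k → GaugeField P (k+1) U1 → HiggsField P (k+1) → ℂ) (W : ι → Cfg P k → GaugeField P (k+1) U1 → HiggsField P (k+1) → ℝ)
    (hfac : ∀ t ∈ terms, ∀ (q : Cfg P k) (v : GaugeField P (k+1) U1) (ψ : HiggsField P (k+1)),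
      J t q.2.1 (surfMul (uPrime q.1) (cutoff (Λ t)ᶜ v)) v q.2.2 ψ = Xf t ((D t).freeze q) v ψ * (W t q v ψ : ℂ) * B t q v ψ)
    (hWm : ∀ t ∈ terms, ∀ v ψ, Measurable fun q => W t q v ψ) (hW0 : ∀ t ∈ terms, ∀ q v ψ, 0 < W t q v ψ)
    (hWi : ∀ t ∈ terms, ∀ (e : (D t).Ext) (v : GaugeField P (k+1) U1) (ψ : HiggsField P (k+1)),
      Integrable (fun i => W t ((D t).glue e i) v ψ) ((D t).μInt (axialLaw P k)))
    (terms' : Finset ι') (π : ι' → ι) (hπ : ∀ c ∈ terms', π c ∈ terms)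
    (C : ι' → Cfg P k → GaugeField P (k+1) U1 → HiggsField P (k+1) → ℂ)
    (hC : ∀ t ∈ terms, ∀ (q : Cfg P k) (v : GaugeField P (k+1) U1) (ψ : HiggsField P (k+1)),
      ∫ q', B t q' v ψ ∂condW (D t) (axialLaw P k) (fun q' => W t q' v ψ) q = ∑ c ∈ terms'.filter (fun c => π c = t), C c q v ψ)
    (hCi : ∀ c ∈ terms', ∀ (v : GaugeField P (k+1) U1) (ψ : HiggsField P (k+1)),
      Integrable (fun q => Xf (π c) q v ψ * (normW (D (π c)) (axialLaw P k) (fun q' => W (π c) q' v ψ) q : ℂ) * C c q v ψ)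
        ((D (π c)).extMeasure (axialLaw P k)))
    (hYm : ∀ c ∈ terms', ∀ (v : GaugeField P (k+1) U1) (ψ : HiggsField P (k+1)),
      Measurable fun q => Xf (π c) q v ψ * (normW (D (π c)) (axialLaw P k) (fun q' => W (π c) q' v ψ) q : ℂ) * C c q v ψ)
    (hole : ι' → Ω) (holes : Finset Ω) (hh : ∀ c ∈ terms', hole c ∈ holes)
    (DΩ : Ω → Interior P k) (hD : ∀ c ∈ terms', D (π c) = DΩ (hole c))
    (KΩ : Ω → Type*) [∀ ω, Fintype (KΩ ω)] [∀ ω, DecidableEq (KΩ ω)]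
    (comp : (ω : Ω) → {x : Balaban1983to89.Site P k // x ∉ (DΩ ω).Ix} → KΩ ω)
    (G : Ω → Prev P (k+1) → GaugeField P (k+1) U1 → HiggsField P (k+1) → ℂ)
    (y : (ω : Ω) → (κ : KΩ ω) → Prev P (k+1) → ({x // comp ω x = κ} → ℂ) → GaugeField P (k+1) U1 → HiggsField P (k+1) → ℂ)
    (hprod : ∀ ω ∈ holes, ∀ (pp : Prev P (k+1)) (e : (DΩ ω).EX) (v : GaugeField P (k+1) U1) (ψ : HiggsField P (k+1)),
      ∑ c ∈ terms'.filter (fun c => hole c = ω),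
          Xf (π c) (cfg41 (DΩ ω) (pp, e)) v ψ * (normW (D (π c)) (axialLaw P k) (fun q' => W (π c) q' v ψ) (cfg41 (DΩ ω) (pp, e)) : ℂ) *
            C c (cfg41 (DΩ ω) (pp, e)) v ψ =
        G ω pp v ψ * ∏ κ, y ω κ pp (fun j => e j.1) v ψ)
    (hYi : ∀ c ∈ terms', ∀ (v : GaugeField P (k+1) U1) (ψ : HiggsField P (k+1)),
      Integrable (fun r => Xf (π c) (cfg41 (DΩ (hole c)) r) v ψ *
          (normW (D (π c)) (axialLaw P k) (fun q' => W (π c) q' v ψ) (cfg41 (DΩ (hole c)) r) : ℂ) * C c (cfg41 (DΩ (hole c)) r) v ψ)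
        ((prevMeasure P (k+1)).prod (volume : Measure (DΩ (hole c)).EX))) :
    uncurry ρL =ᵐ[(fieldMeasure P (k+1) U1).prod volume]
      uncurry (fun v ψ => ∑ ω ∈ holes, ∫ pp, (G ω pp v ψ * ∏ κ, ∫ w : {x // comp ω x = κ} → ℂ, y ω κ pp w v ψ) ∂prevMeasure P (k+1)) := by
  have hR := result41_ae_eq hk h hJi hi D Xf B W hfac hWm hW0 hWi terms' π hπ C hC hCi hYm hole holes hh
  refine ae_eq_hole_product
    (Y := fun c q v ψ => Xf (π c) q v ψ * (normW (D (π c)) (axialLaw P k) (fun q' => W (π c) q' v ψ) q : ℂ) * C c q v ψ)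
    (fun c => D (π c)) holes (fun ω => terms'.filter fun c => hole c = ω) hR DΩ ?_ KΩ comp G y hprod ?_
  · intro ω _ c hc
    obtain ⟨hc', hcω⟩ := Finset.mem_filter.mp hc
    rw [← hcω]
    exact hD c hc'
  · intro ω _ c hc v ψ
    obtain ⟨hc', rfl⟩ := Finset.mem_filter.mp hc
    exact hYi c hc' v ψ

end Chain

end

end Literature.MathematicalPhysics.QuantumFieldTheory.BalabanImbrieJaffe1984to88.BIJ88HoleProduct5154
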